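import Summits.QuantumFields.BalabanUV.Beta.CombHId1Sandwich

/-!
# `BalabanUV.Beta.CombHId2Product` — binder row D1 (OWNER an2), (J-a) dictionary, (C2) at ORDER 2, part TWO-a: **THE PRODUCT RULE FOR PERIODISED
# TWO-INSERTION WORDS** — an invariant decaying word `A` passes inside the diagonal periodisation of a bi-localised insertion (`A ∘ dper X′ ∘ K = dper (A ∘ X′ ∘ K)`),
# so the torus product `Â·X̂·Â·X̂′·Â` IS the periodisation of the lattice word `(K·dper X·K)·X′·K` — AND THE COPY-SUM READING `Σ'_n dper M (B ∘ V_n) = dper M B ∘ dper M V`: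
# the engine for `K3OfK`'s `dM_b·K·dM_{b′}` words (the `hId₂` chain, part TWO-a)

WHY.  `K3OfK K N S M W b b′ = −K·dM_b·K2_{b′} − K·dM_{b′}·K2_b − K·W_{bb′}·K` (`BalabanStepW2` :543) carries TWO insertions at DIFFERENT coarse bonds; on the
torus the door's `hId₂` word multiplies the periodised one-insertion blocks.  The lattice ↔ torus match for such products is: periodise the first sandwich
(`dper_sandwich`, C2b), then pass the resulting INVARIANT word through the second insertion's period sum (gan24-p3's `comp_dper_left ∕ right`).
WHAT ([folklore]; 0 `def`, 0 cited fact, 0 `def … : Prop`, 0 sorry): §1 `translate_inv_dper` (every `dper` is invariant), `translate_inv_sandwich_dper`,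
**`comp_sandwich_dper_comp_dper`**: `((K ∘ dper M X ∘ K) ∘ dper M X′) ∘ K = dper M (((K ∘ dper M X ∘ K) ∘ X′) ∘ K)` for `K` invariant + decaying, `X, X′` bi-localised;
§2 THE COPY-SUM READING: `comp_translate_copy_eq`, `abs_copy_term_le`, `summable_copy_family` (the triple family `((n,m),y) ↦ Σ_f B(x+M∘m)(y+M∘m)·V(y+M∘(m+n))(z+M∘(m+n))`
is absolutely summable — re-indexed `((n, m), y) ↦ (m, (m + n, y + M∘m))` to a product of three exponentials), `tsum_copy_family_fst`, and
**`tsum_dper_comp_translate`**: `Σ'_n dper M (B ∘ V_n) = dper M B ∘ dper M V` (`V_n` = the `n`-th period copy of the second insertion) — summing the second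
insertion's copies INDEPENDENTLY of the diagonal period sum gives the product of the two periodisations (the lattice meaning of the torus product `B̂·V̂`).
NOT HERE: `K3OfK`, `e4OfKW`, the door's `hId₂`; nothing of Bałaban's asserted; NOT D1, NEVER «G-an2-4 closed», NOT BetaPertH, NOT continuum, NOT Clay.

HONEST DEPENDENCY (page 1, mandatory): continuum YM on T⁴ ⇐ BetaPertH ∧ nine spine estimates (0/9 proved); BetaPertH ⇐ (D1) ∧ (D4) ∧ CAP+tail;
G-an2-4 gates asym, D1 and NE2/3/4.  HONEST FRAMING (cell contract, verbatim): «discharging `BetaPertH` makes Bałaban's UV stability UNCONDITIONAL —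
a real constructive-QFT result; it is NOT the continuum limit and NOT the Clay problem.»  ABSOLUTE RULE (cell charter, verbatim): «No internally-minted
statement may enter as a cited fact. Every hypothesis is either kernel-proved in this package or a verbatim quotation of a PUBLISHED theorem with page
reference. The manuscript(s) under audit are NOT citable for their own disputed steps — they are the thing under adjudication; programme-internal
(2001/route/tribunal) claims are never citable.»  Row D1 OWNER an2 (b2b-balaban-beta-an2) gen 43, 2026-08-22; over C2b and gan24-p3's `KernelPeriodisationFibLoc` BY NAME.
-/

noncomputable section

namespace Summit.QuantumFields.BalabanUV.Beta.CombHId2Product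

open Literature.MathematicalPhysics.QuantumFieldTheory.Balaban1983to89
open Literature.MathematicalPhysics.QuantumFieldTheory.Balaban1983to89.Beta
open B4TorusKernel.MultiPeriod (translate translate_apply)
open B4Reflection242 (translate_translate)
open B12Sec2to5 (l1 l1_nonneg)
open B4Sect5Proof (latticeConst latticeConst_nonneg)
open ExpKernelCalculus (MKer Decays BiLoc comp)
open AffineAveraging (Site)
open OneStepResolventKernel (Fib decays_mono biLoc_mono)
open Summit.QuantumFields.BalabanUV.Beta.TameKernelCalculus
open Summit.QuantumFields.BalabanUV.Beta.FP.KernelPeriodisationFibLoc (dper dper_apply dper_translate decays_dper decays_dper_diag comp_dper_left comp_dper_right)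
open Summit.QuantumFields.BalabanUV.Beta.CombHId1Sandwich (dper_sandwich comp_translate_inv exists_decays_comp)

variable {d : ℕ} (M : Fin (d + 1) → ℕ) [∀ μ, NeZero (M μ)] {K : MKer (d + 1) (Fib d)}

/-! ## §1 The product rule -/

omit [∀ μ, NeZero (M μ)] in
/-- [folklore] every diagonal periodisation is invariant under the period lattice (`dper_translate`, in the `hKinv` shape). -/
theorem translate_inv_dper (X : MKer (d + 1) (Fib d)) (m x z : Site (d + 1)) (a b : Fib d) :
    dper M X (translate M x m) (translate M z m) a b = dper M X x z a b :=
  dper_translate M X m x z a b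

omit [∀ μ, NeZero (M μ)] in
/-- [folklore] the periodised sandwich `K ∘ dper M X ∘ K` is invariant under the period lattice when `K` is. -/
theorem translate_inv_sandwich_dper
    (hKinv : ∀ (m x z : Site (d + 1)) (a b : Fib d), K (translate M x m) (translate M z m) a b = K x z a b) (X : MKer (d + 1) (Fib d))
    (m x z : Site (d + 1)) (a b : Fib d) :
    comp (comp K (dper M X)) K (translate M x m) (translate M z m) a b = comp (comp K (dper M X)) K x z a b :=
  comp_translate_inv M (comp_translate_inv M hKinv (translate_inv_dper M X)) hKinv m x z a b

/-- [folklore] **THE PRODUCT RULE**: for `K` invariant under the period lattice and decaying, `X` bi-localised at `(p, p)` and `X′` at `(q, q)`,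
`((K ∘ dper M X ∘ K) ∘ dper M X′) ∘ K = dper M (((K ∘ dper M X ∘ K) ∘ X′) ∘ K)` — the invariant decaying word `A := K ∘ dper M X ∘ K` passes inside the second
insertion's period sum (`comp_dper_left`), then the right factor `K` (`comp_dper_right`). -/
theorem comp_sandwich_dper_comp_dper
    (hKinv : ∀ (m x z : Site (d + 1)) (a b : Fib d), K (translate M x m) (translate M z m) a b = K x z a b)
    {CK δK CX δX CX' δX' : ℝ} (hK : Decays K CK δK) (hδK : 0 < δK)
    {X X' : MKer (d + 1) (Fib d)} {p q : Site (d + 1)} (hX : BiLoc X p p CX δX) (hδX : 0 < δX) (hX' : BiLoc X' q q CX' δX') (hδX' : 0 < δX') :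
    comp (comp (comp (comp K (dper M X)) K) (dper M X')) K = dper M (comp (comp (comp (comp K (dper M X)) K) X') K) := by
  have hCX : 0 ≤ CX := hX.nonneg (Sum.inl 0)
  -- `A := K ∘ dper X ∘ K` decays and is invariant
  have hdX := decays_dper_diag M hX hCX hδX
  obtain ⟨C₁, δ₁, hδ₁, h1⟩ := exists_decays_comp hK hδK hdX (half_pos hδX)
  obtain ⟨CA, δA, hδA, hA⟩ := exists_decays_comp h1 hδ₁ hK hδK
  have hAinv := translate_inv_sandwich_dper M hKinv X
  -- pass `A` inside, then `K`
  have hCA : 0 ≤ CA := hA.nonneg (Sum.inl 0)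
  have hCX' : 0 ≤ CX' := hX'.nonneg (Sum.inl 0)
  have hδ₀ : 0 < min δA δX' := lt_min hδA hδX'
  have hAX' : BiLoc (comp (comp (comp K (dper M X)) K) X') q q _ (min δA δX' / 2) :=
    ExpKernelCalculus.biLoc_comp_decays (decays_mono hA hCA le_rfl (min_le_left δA δX')) (biLoc_mono hX' hCX' (min_le_right δA δX'))
      (half_pos hδ₀).le (half_lt_self hδ₀)
  rw [comp_dper_left M hA hδA hAinv hX' hδX', comp_dper_right M hAX' (half_pos hδ₀) hK hδK hKinv]

/-! ## §2 The copy-sum reading: the second insertion's period copies -/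

section CopySum

variable {B V : MKer (d + 1) (Fib d)} {p q : Site (d + 1)} {CB δB CV δV : ℝ}

omit [∀ μ, NeZero (M μ)] in
/-- [folklore] translate by `0`. -/
theorem translate_zero_right (y : Site (d + 1)) : translate M y 0 = y := by
  funext i; rw [translate_apply, Pi.zero_apply, mul_zero, add_zero]

omit [∀ μ, NeZero (M μ)] in
/-- [folklore] a kernel bi-localised at `(p, p)` is bounded along the joint period translates by the ROW decay alone. -/
theorem abs_translate_le_row (hB : BiLoc B p p CB δB) (hδB : 0 ≤ δB) (x y m : Site (d + 1)) (a f : Fib d) :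
    |B (translate M x m) (translate M y m) a f| ≤ CB * Real.exp (-δB * l1 (translate M x m - p)) := by
  have hCB : 0 ≤ CB := hB.nonneg (Sum.inl 0)
  refine (hB _ _ a f).trans ?_
  rw [mul_add, Real.exp_add]
  have h1 : Real.exp (-δB * l1 (translate M y m - p)) ≤ 1 := by
    rw [Real.exp_le_one_iff]; exact mul_nonpos_of_nonpos_of_nonneg (neg_nonpos.2 hδB) (l1_nonneg _)
  calc CB * (Real.exp (-δB * l1 (translate M x m - p)) * Real.exp (-δB * l1 (translate M y m - p)))
      ≤ CB * (Real.exp (-δB * l1 (translate M x m - p)) * 1) :=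
        mul_le_mul_of_nonneg_left (mul_le_mul_of_nonneg_left h1 (Real.exp_pos _).le) hCB
    _ = CB * Real.exp (-δB * l1 (translate M x m - p)) := by rw [mul_one]

omit [∀ μ, NeZero (M μ)] in
/-- [folklore] … and by the COLUMN decay alone. -/
theorem abs_translate_le_col (hV : BiLoc V q q CV δV) (hδV : 0 ≤ δV) (y z k : Site (d + 1)) (f b : Fib d) :
    |V (translate M y k) (translate M z k) f b| ≤ CV * Real.exp (-δV * l1 (translate M z k - q)) := by
  have hCV : 0 ≤ CV := hV.nonneg (Sum.inl 0)
  refine (hV _ _ f b).trans ?_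
  rw [mul_add, Real.exp_add]
  have h1 : Real.exp (-δV * l1 (translate M y k - q)) ≤ 1 := by
    rw [Real.exp_le_one_iff]; exact mul_nonpos_of_nonpos_of_nonneg (neg_nonpos.2 hδV) (l1_nonneg _)
  calc CV * (Real.exp (-δV * l1 (translate M y k - q)) * Real.exp (-δV * l1 (translate M z k - q)))
      ≤ CV * (1 * Real.exp (-δV * l1 (translate M z k - q))) :=
        mul_le_mul_of_nonneg_left (mul_le_mul_of_nonneg_right h1 (Real.exp_pos _).le) hCV
    _ = CV * Real.exp (-δV * l1 (translate M z k - q)) := by rw [one_mul]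

omit [∀ μ, NeZero (M μ)] in
/-- [folklore] the `n`-th copy's sandwich read at the `m`-th diagonal translate, re-indexed to the summand family
`((n, m), y) ↦ Σ_f B (x + M∘m) (y + M∘m) · V (y + M∘(m+n)) (z + M∘(m+n))`. -/
theorem comp_translate_copy_eq (x z n m : Site (d + 1)) (a b : Fib d) :
    comp B (fun x' z' a' b' => V (translate M x' n) (translate M z' n) a' b') (translate M x m) (translate M z m) a b
      = ∑' y, ∑ f, B (translate M x m) (translate M y m) a f * V (translate M y (m + n)) (translate M z (m + n)) f b := by
  show (∑' y₀, ∑ f, B (translate M x m) y₀ a f * V (translate M y₀ n) (translate M (translate M z m) n) f b) = _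
  rw [← (Equiv.addRight (fun i => (M i : ℤ) * m i)).tsum_eq
    (fun y₀ => ∑ f, B (translate M x m) y₀ a f * V (translate M y₀ n) (translate M (translate M z m) n) f b)]
  refine tsum_congr fun y => ?_
  have e : (Equiv.addRight (fun i => (M i : ℤ) * m i)) y = translate M y m := by
    rw [Equiv.coe_addRight, FP.KernelPeriodisationFib.translate_eq_add]
  simp only [e, translate_translate]

omit [∀ μ, NeZero (M μ)] in
/-- [folklore] the pointwise bound of one term of the triple family by a product of three exponentials. -/
theorem abs_copy_term_le (hB : BiLoc B p p CB δB) (hV : BiLoc V q q CV δV) (hδV : 0 ≤ δV) (x z n m y : Site (d + 1)) (a b : Fib d) :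
    |∑ f, B (translate M x m) (translate M y m) a f * V (translate M y (m + n)) (translate M z (m + n)) f b|
      ≤ ((Fintype.card (Fib d) : ℝ) * (CB * CV) * Real.exp (-δB * l1 (translate M x m - p)))
        * (Real.exp (-δV * l1 (translate M z (m + n) - q)) * Real.exp (-δB * l1 (translate M y m - p))) := by
  have hCB : 0 ≤ CB := hB.nonneg (Sum.inl 0)
  have hBt : ∀ f, |B (translate M x m) (translate M y m) a f|
      ≤ CB * Real.exp (-δB * (l1 (translate M x m - p) + l1 (translate M y m - p))) := fun f => hB _ _ a f
  have hVt : ∀ f, |V (translate M y (m + n)) (translate M z (m + n)) f b| ≤ CV * Real.exp (-δV * l1 (translate M z (m + n) - q)) :=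
    fun f => abs_translate_le_col M hV hδV y z (m + n) f b
  calc |∑ f, B (translate M x m) (translate M y m) a f * V (translate M y (m + n)) (translate M z (m + n)) f b|
      ≤ ∑ f, |B (translate M x m) (translate M y m) a f * V (translate M y (m + n)) (translate M z (m + n)) f b| :=
        Finset.abs_sum_le_sum_abs _ _
    _ ≤ ∑ _f : Fib d, (CB * Real.exp (-δB * (l1 (translate M x m - p) + l1 (translate M y m - p))))
          * (CV * Real.exp (-δV * l1 (translate M z (m + n) - q))) :=
        Finset.sum_le_sum fun f _ => by
          rw [abs_mul]
          exact mul_le_mul (hBt f) (hVt f) (abs_nonneg _) (mul_nonneg hCB (Real.exp_pos _).le)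
    _ = ((Fintype.card (Fib d) : ℝ) * (CB * CV) * Real.exp (-δB * l1 (translate M x m - p)))
          * (Real.exp (-δV * l1 (translate M z (m + n) - q)) * Real.exp (-δB * l1 (translate M y m - p))) := by
        rw [Finset.sum_const, Finset.card_univ, nsmul_eq_mul, mul_add, Real.exp_add]; ring

/-- [folklore] **ABSOLUTE SUMMABILITY OF THE TRIPLE FAMILY** `((n, m), y) ↦ Σ_f B (x + M∘m) (y + M∘m) · V (y + M∘(m+n)) (z + M∘(m+n))`
(re-index `((n, m), y) ↦ (m, (m + n, y + M∘m))`; the bound is then a product of three summable exponentials). -/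
theorem summable_copy_family (hB : BiLoc B p p CB δB) (hδB : 0 < δB) (hV : BiLoc V q q CV δV) (hδV : 0 < δV)
    (x z : Site (d + 1)) (a b : Fib d) :
    Summable fun t : (Site (d + 1) × Site (d + 1)) × Site (d + 1) =>
      ∑ f, B (translate M x t.1.2) (translate M t.2 t.1.2) a f * V (translate M t.2 (t.1.2 + t.1.1)) (translate M z (t.1.2 + t.1.1)) f b := by
  have hCB : 0 ≤ CB := hB.nonneg (Sum.inl 0)
  have hCV : 0 ≤ CV := hV.nonneg (Sum.inl 0)
  have hC₀ : 0 ≤ (Fintype.card (Fib d) : ℝ) * (CB * CV) := by positivity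
  -- the product bound `g`, written directly on `((n, m), y)`, and its summability through the re-indexing
  -- `((n, m), y) ↦ (m, (m + n, y + M∘m))`
  let g : (Site (d + 1) × Site (d + 1)) × Site (d + 1) → ℝ := fun t =>
    ((Fintype.card (Fib d) : ℝ) * (CB * CV) * Real.exp (-δB * l1 (translate M x t.1.2 - p)))
      * (Real.exp (-δV * l1 (translate M z (t.1.2 + t.1.1) - q)) * Real.exp (-δB * l1 (translate M t.2 t.1.2 - p)))
  let G : Site (d + 1) × (Site (d + 1) × Site (d + 1)) → ℝ := fun s =>
    ((Fintype.card (Fib d) : ℝ) * (CB * CV) * Real.exp (-δB * l1 (translate M x s.1 - p)))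
      * (Real.exp (-δV * l1 (translate M z s.2.1 - q)) * Real.exp (-δB * l1 (s.2.2 - p)))
  have h1 : Summable fun m : Site (d + 1) => (Fintype.card (Fib d) : ℝ) * (CB * CV) * Real.exp (-δB * l1 (translate M x m - p)) :=
    ((FP.KernelPeriodisationFibLoc.summable_exp_l1_translate M hδB p x).1).mul_left _
  have h2 : Summable fun k : Site (d + 1) => Real.exp (-δV * l1 (translate M z k - q)) :=
    (FP.KernelPeriodisationFibLoc.summable_exp_l1_translate M hδV q z).1
  have h3 : Summable fun y' : Site (d + 1) => Real.exp (-δB * l1 (y' - p)) := ExpKernelCalculus.summable_exp_shift' hδB p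
  have h23 : Summable fun r : Site (d + 1) × Site (d + 1) =>
      Real.exp (-δV * l1 (translate M z r.1 - q)) * Real.exp (-δB * l1 (r.2 - p)) :=
    h2.mul_of_nonneg h3 (fun _ => (Real.exp_pos _).le) (fun _ => (Real.exp_pos _).le)
  have hG : Summable G :=
    h1.mul_of_nonneg h23 (fun _ => mul_nonneg hC₀ (Real.exp_pos _).le) (fun _ => mul_nonneg (Real.exp_pos _).le (Real.exp_pos _).le)
  let φ : (Site (d + 1) × Site (d + 1)) × Site (d + 1) ≃ Site (d + 1) × (Site (d + 1) × Site (d + 1)) :=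
    { toFun := fun t => (t.1.2, (t.1.2 + t.1.1, translate M t.2 t.1.2))
      invFun := fun s => ((s.2.1 - s.1, s.1), translate M s.2.2 (-s.1))
      left_inv := fun t => by
        obtain ⟨⟨n, m⟩, y⟩ := t
        simp only [add_sub_cancel_left, translate_translate, add_neg_cancel, translate_zero_right]
      right_inv := fun s => by
        obtain ⟨m, k, y'⟩ := s
        simp only [add_sub_cancel, translate_translate, neg_add_cancel, translate_zero_right] }
  have hg : Summable g := by
    have h := φ.summable_iff.mpr hG
    exact h.congr fun t => rfl
  refine Summable.of_norm_bounded hg fun t => ?_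
  obtain ⟨⟨n, m⟩, y⟩ := t
  rw [Real.norm_eq_abs]
  exact abs_copy_term_le M hB hV hδV.le x z n m y a b

/-- [folklore] for fixed `y`, the double sum over `(n, m)` factorises into `Σ_f dper B (x, y) · dper V (y, z)` (re-index `(n, m) ↦ (m, m + n)`;
both factors absolutely summable). -/
theorem tsum_copy_family_fst (hB : BiLoc B p p CB δB) (hδB : 0 < δB) (hV : BiLoc V q q CV δV) (hδV : 0 < δV)
    (x z y : Site (d + 1)) (a b : Fib d) :
    (∑' nm : Site (d + 1) × Site (d + 1),
        ∑ f, B (translate M x nm.2) (translate M y nm.2) a f * V (translate M y (nm.2 + nm.1)) (translate M z (nm.2 + nm.1)) f b)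
      = ∑ f, dper M B x y a f * dper M V y z f b := by
  have hBs : ∀ f : Fib d, Summable fun m : Site (d + 1) => ‖B (translate M x m) (translate M y m) a f‖ := fun f =>
    (((FP.KernelPeriodisationFibLoc.summable_exp_l1_translate M hδB p x).1).mul_left CB).of_nonneg_of_le (fun _ => norm_nonneg _)
      fun m => by rw [Real.norm_eq_abs]; exact abs_translate_le_row M hB hδB.le x y m a f
  have hVs : ∀ f : Fib d, Summable fun k : Site (d + 1) => ‖V (translate M y k) (translate M z k) f b‖ := fun f =>
    (((FP.KernelPeriodisationFibLoc.summable_exp_l1_translate M hδV q z).1).mul_left CV).of_nonneg_of_le (fun _ => norm_nonneg _)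
      fun k => by rw [Real.norm_eq_abs]; exact abs_translate_le_col M hV hδV.le y z k f b
  let ψ : Site (d + 1) × Site (d + 1) ≃ Site (d + 1) × Site (d + 1) :=
    { toFun := fun mk => (mk.2 - mk.1, mk.1)
      invFun := fun nm => (nm.2, nm.2 + nm.1)
      left_inv := fun mk => by obtain ⟨m, k⟩ := mk; simp only [add_sub_cancel]
      right_inv := fun nm => by obtain ⟨n, m⟩ := nm; simp only [add_sub_cancel_left] }
  rw [← ψ.tsum_eq]
  have hψ : ∀ mk : Site (d + 1) × Site (d + 1),
      (∑ f, B (translate M x (ψ mk).2) (translate M y (ψ mk).2) a f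
          * V (translate M y ((ψ mk).2 + (ψ mk).1)) (translate M z ((ψ mk).2 + (ψ mk).1)) f b)
        = ∑ f, B (translate M x mk.1) (translate M y mk.1) a f * V (translate M y mk.2) (translate M z mk.2) f b := fun mk => by
    obtain ⟨m, k⟩ := mk
    show (∑ f, B (translate M x m) (translate M y m) a f * V (translate M y (m + (k - m))) (translate M z (m + (k - m))) f b) = _
    rw [add_sub_cancel]
  simp only [hψ]
  rw [Summable.tsum_finsetSum (fun f _ => summable_mul_of_summable_norm (hBs f) (hVs f))]
  refine Finset.sum_congr rfl fun f _ => ?_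
  rw [dper_apply, dper_apply, tsum_mul_tsum_of_summable_norm (hBs f) (hVs f)]

/-- [folklore] **THE COPY-SUM READING OF A PERIODISED TWO-INSERTION WORD**: for `B` bi-localised at `(p, p)` and `V` at `(q, q)`,
`Σ'_n dper M (B ∘ V_n) = dper M B ∘ dper M V` (pointwise), where `V_n x′ z′ := V (x′ + M∘n) (z′ + M∘n)` is the `n`-th period copy of the second insertion:
summing the second insertion's copies INDEPENDENTLY of the diagonal period sum yields the product of the two periodisations. -/
theorem tsum_dper_comp_translate (hB : BiLoc B p p CB δB) (hδB : 0 < δB) (hV : BiLoc V q q CV δV) (hδV : 0 < δV)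
    (x z : Site (d + 1)) (a b : Fib d) :
    ∑' n : Site (d + 1), dper M (comp B (fun x' z' a' b' => V (translate M x' n) (translate M z' n) a' b')) x z a b
      = comp (dper M B) (dper M V) x z a b := by
  have hF := summable_copy_family M hB hδB hV hδV x z a b
  -- left side = iterated sum (n, m, y) of the family
  have hL : (∑' n : Site (d + 1), dper M (comp B (fun x' z' a' b' => V (translate M x' n) (translate M z' n) a' b')) x z a b)
      = ∑' nm : Site (d + 1) × Site (d + 1), ∑' y,
          ∑ f, B (translate M x nm.2) (translate M y nm.2) a f * V (translate M y (nm.2 + nm.1)) (translate M z (nm.2 + nm.1)) f b := by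
    simp only [dper_apply, comp_translate_copy_eq]
    exact (hF.prod.tsum_prod).symm
  -- swap: `y` outermost
  have hF' : Summable (Function.uncurry fun (nm : Site (d + 1) × Site (d + 1)) (y : Site (d + 1)) =>
      ∑ f, B (translate M x nm.2) (translate M y nm.2) a f * V (translate M y (nm.2 + nm.1)) (translate M z (nm.2 + nm.1)) f b) :=
    hF.congr fun t => by obtain ⟨nm, y⟩ := t; rfl
  rw [hL, ← hF'.tsum_comm]
  simp only [tsum_copy_family_fst M hB hδB hV hδV]
  rfl

end CopySum

end Summit.QuantumFields.BalabanUV.Beta.CombHId2Product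

end
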